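import Summits.ABC.IUTFork.Repair.RHReqsideWeightLawsSegmentShift
import HarnessLib

/-!
# D-0122 AXIS B, knob k1 — THE TYPED FORM, part 3j: `κ = 5/2` IS DOWNWARD CLOSED — the integer increment certificate
# `2(⌈j^{5/2}⌉ − 1) ≤ (⌈(j+1)^{5/2}⌉ − ⌈j^{5/2}⌉)·j` for every `j ≥ 1`, feeding part 3h's closure theorem

abc-iut cell, rung LADDER-ABC:A2.RESCUE.H; seat abc-iut-reqb-typ-1 (GEN 3; D-0122 axis B typer k1/k4; R69 (A1) hardening queue); owner abc-iut-rh-lead g4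
(`plan/rescue/R-H/ROUND3/REQB-SPEC.md` v0.2 §1 k1 `κ ∈ {1, 3/2, 2, 5/2}`, §3 column «seg violations» — 0 on the bed for row S-k1-kappa5/2, an engine fact).
Parts 3h/3i = p524026 `Repair/RHReqsideWeightLawsSegment.lean` (closure for laws with `Δf ≥ 0`, `Δf·j ≥ 2(f(j) − 1)`: print, `κ = 3`, affine `c ≥ 1`;
non-segment witnesses for `κ = 1`, `κ = 3/2`) / p524917 (shift `a = 2` witness); `κ = 5/2` was left open there. Nothing re-typed.
* `lawPow_five_increment` — **for every `j ≥ 1`: `2·(⌈j^{5/2}⌉ − 1) ≤ (⌈(j+1)^{5/2}⌉ − ⌈j^{5/2}⌉)·j`**, by squares only (no root evaluated): with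
  `s = ⌈j^{5/2}⌉`, `t = ⌈(j+1)^{5/2}⌉` one has `(s − 1)² < j⁵` (minimality of `⌈√·⌉`), so `s − 1 ≤ j³`, and `t² ≥ (j+1)⁵`; then
  `((j+2)(s−1) + j + 1)² ≤ (j+2)²(j⁵ − 1) + 2(j+2)(j+1)j³ + (j+1)² ≤ j²(j+1)⁵ ≤ (j·t)²` (the middle step is the polynomial identity
  `j²(j+1)⁵ − [(j+2)²(j⁵−1) + 2(j+2)(j+1)j³ + (j+1)²] = j⁶ + 4j⁵ + 4j⁴ + j³ + j² + 2j + 3 ≥ 0`), whence `(j+2)(s−1) + j + 1 ≤ j·t`, i.e. the claim with room `1`.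
* `cell_lawPow_five_of_succ` — **`κ = 5/2` IS DOWNWARD CLOSED** under the local-field hypotheses (`0 < e`, `e − 1 ≤ δ`, `r_out ≤ r_in`, `0 ≤ m`, `j ≥ 1`):
  `Cell_{j+1} ⟹ Cell_j` (part 3h `cell_of_cell_succ` + the certificate + `lawPow_mono`). So «seg = 1» is a THEOREM for rows S-k1-kappa5/2 and its pairs —
  the dichotomy of parts 3h–3j now reads: closure PROVED for print, `κ = 5/2`, `κ = 3`, affine `c ≥ 1`; REFUTED as a law property (tame-type integer
  witnesses) for `κ = 1`, `κ = 3/2`, shift `a = 2`; open only for shift `a = 1` (no violation found in ≈ 2·10⁶ configurations; bed 0 violations).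
HONEST FRAMING: integer arithmetic about OUR typed cell with a free pilot law (a PARAMETER — REQB-SPEC FRAMING); nothing here asserts that abc is proved or
refuted, or that [IUTchIII] Cor. 3.12 / [IUTchIV] Thm. 1.10 holds or fails at any datum, or takes a side on any author; typed ≠ proved; computed ≠ proved.
[claim: Mochizuki2012, status: disputed] for every IUT locution. [cite: Mochizuki2012, IUTchIV Prop. 1.2 (i)(ii) p. 10, Prop. 1.4 p. 13]
-/

namespace Summit.ABC.IUTFork.Repair.RH.ReqsideWeightLaws

/-- `(⌈√n⌉ − 1)² < n` for `n ≥ 1` (minimality of the ceiling square root; in `ℕ` with `⌈√n⌉ ≥ 1`). [folklore] -/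
theorem ceilSqrt_pred_sq_lt {n : ℕ} (hn : 1 ≤ n) : (ceilSqrt n - 1) ^ 2 < n := by
  by_contra h
  push Not at h
  have h1 : ceilSqrt n ≤ ceilSqrt n - 1 := ceilSqrt_le_of_le_sq h
  have h2 : 1 ≤ ceilSqrt n := succ_le_ceilSqrt_of_sq_lt (by simp; omega)
  omega

/-- **THE `κ = 5/2` INCREMENT CERTIFICATE**: for every `j ≥ 1`, `2·(⌈j^{5/2}⌉ − 1) ≤ (⌈(j+1)^{5/2}⌉ − ⌈j^{5/2}⌉)·j` (squares only; see the module
docstring for the chain of integer inequalities). [folklore] -/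
theorem lawPow_five_increment {j : ℕ} (hj : 1 ≤ j) : 2 * (lawPow 5 j - 1) ≤ (lawPow 5 (j + 1) - lawPow 5 j) * (j : ℤ) := by
  -- `s = ⌈√(j⁵)⌉ ≥ 1`, `v = s − 1` with `v² < j⁵`; `t = ⌈√((j+1)⁵)⌉` with `(j+1)⁵ ≤ t²`
  have hj5 : 1 ≤ j ^ 5 := Nat.one_le_pow _ _ hj
  have hs1 : 1 ≤ ceilSqrt (j ^ 5) := succ_le_ceilSqrt_of_sq_lt (by simp; omega)
  have hv : (ceilSqrt (j ^ 5) - 1) ^ 2 < j ^ 5 := ceilSqrt_pred_sq_lt hj5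
  have ht : (j + 1) ^ 5 ≤ ceilSqrt ((j + 1) ^ 5) ^ 2 := le_ceilSqrt_sq _
  -- move to `ℤ`
  set s : ℕ := ceilSqrt (j ^ 5) with hs
  set t : ℕ := ceilSqrt ((j + 1) ^ 5) with ht'
  have hS : lawPow 5 j = (s : ℤ) := rfl
  have hT : lawPow 5 (j + 1) = (t : ℤ) := rfl
  rw [hS, hT]
  obtain ⟨v, hvs⟩ : ∃ v : ℕ, s = v + 1 := ⟨s - 1, by omega⟩
  have hv' : v ^ 2 < j ^ 5 := by rw [hvs] at hv; simpa using hv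
  have hvZ : ((v : ℤ)) ^ 2 ≤ (j : ℤ) ^ 5 - 1 := by
    have : (v : ℤ) ^ 2 < (j : ℤ) ^ 5 := by exact_mod_cast hv'
    linarith
  have htZ : ((j : ℤ) + 1) ^ 5 ≤ (t : ℤ) ^ 2 := by exact_mod_cast ht
  have hj' : (1 : ℤ) ≤ (j : ℤ) := by exact_mod_cast hj
  have hv0 : (0 : ℤ) ≤ (v : ℤ) := Nat.cast_nonneg v
  have ht0 : (0 : ℤ) ≤ (t : ℤ) := Nat.cast_nonneg t
  -- `v ≤ j³` (since `v² < j⁵ ≤ j⁶`)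
  have hvj : (v : ℤ) ≤ (j : ℤ) ^ 3 := by
    by_contra hlt
    push Not at hlt
    have h6 := mul_self_lt_mul_self (by positivity : (0 : ℤ) ≤ (j : ℤ) ^ 3) hlt
    nlinarith [pow_le_pow_right₀ hj' (by norm_num : 5 ≤ 6)]
  -- the polynomial step: `((j+2)v + j + 1)² ≤ j²(j+1)⁵`
  have hpoly : (((j : ℤ) + 2) * v + j + 1) ^ 2 ≤ (j : ℤ) ^ 2 * ((j : ℤ) + 1) ^ 5 := by
    have hA : (((j : ℤ) + 2) * v + j + 1) ^ 2 =
        ((j : ℤ) + 2) ^ 2 * (v : ℤ) ^ 2 + 2 * ((j : ℤ) + 2) * ((j : ℤ) + 1) * v + ((j : ℤ) + 1) ^ 2 := by ring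
    rw [hA]
    have hB : ((j : ℤ) + 2) ^ 2 * (v : ℤ) ^ 2 ≤ ((j : ℤ) + 2) ^ 2 * ((j : ℤ) ^ 5 - 1) :=
      mul_le_mul_of_nonneg_left hvZ (by positivity)
    have hC : 2 * ((j : ℤ) + 2) * ((j : ℤ) + 1) * v ≤ 2 * ((j : ℤ) + 2) * ((j : ℤ) + 1) * (j : ℤ) ^ 3 :=
      mul_le_mul_of_nonneg_left hvj (by positivity)
    nlinarith [pow_nonneg (by linarith : (0 : ℤ) ≤ j) 3, pow_nonneg (by linarith : (0 : ℤ) ≤ j) 4, pow_nonneg (by linarith : (0 : ℤ) ≤ j) 5,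
      pow_nonneg (by linarith : (0 : ℤ) ≤ j) 6]
  -- hence `((j+2)v + j + 1)² ≤ (j t)²` and, both sides nonneg, `(j+2)v + j + 1 ≤ j t`
  have hsq : (((j : ℤ) + 2) * v + j + 1) ^ 2 ≤ ((j : ℤ) * t) ^ 2 := by
    have : (j : ℤ) ^ 2 * ((j : ℤ) + 1) ^ 5 ≤ ((j : ℤ) * t) ^ 2 := by
      rw [mul_pow]; exact mul_le_mul_of_nonneg_left htZ (by positivity)
    linarith
  have hlin : ((j : ℤ) + 2) * v + j + 1 ≤ (j : ℤ) * t := by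
    by_contra hlt
    push Not at hlt
    have h0 : (0 : ℤ) ≤ (j : ℤ) * t := mul_nonneg (by linarith) ht0
    nlinarith [mul_self_lt_mul_self h0 hlt]
  push_cast [hvs]
  nlinarith

/-- **`κ = 5/2` IS DOWNWARD CLOSED** (`0 < e`, `e − 1 ≤ δ`, `r_out ≤ r_in`, `0 ≤ m`, `j ≥ 1`): `Cell (lawPow 5) 1 … (j+1) ⟹ Cell (lawPow 5) 1 … j` — part 3h's
`cell_of_cell_succ` with the increment certificate and `lawPow_mono`. «seg = 1» is a theorem for the `κ = 5/2` rows. [folklore] -/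
theorem cell_lawPow_five_of_succ {e m δ rin rout : ℤ} (he : 0 < e) (hδ : e - 1 ≤ δ) (hio : rout ≤ rin) (hm : 0 ≤ m) {j : ℕ} (hj : 1 ≤ j)
    (h : Cell (lawPow 5) 1 e m δ rin rout (j + 1)) : Cell (lawPow 5) 1 e m δ rin rout j :=
  cell_of_cell_succ he hδ hio hm hj (sub_nonneg.mpr (lawPow_mono (Nat.le_succ j))) (lawPow_five_increment hj) h

/-- … hence failure is monotone in the label under `κ = 5/2`: `¬ Cell_j ⟹ ¬ Cell_{j'}` for `1 ≤ j ≤ j'`. [folklore] -/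
theorem not_cell_lawPow_five_mono {e m δ rin rout : ℤ} (he : 0 < e) (hδ : e - 1 ≤ δ) (hio : rout ≤ rin) (hm : 0 ≤ m) {j j' : ℕ}
    (hj : 1 ≤ j) (hjj : j ≤ j') (h : ¬ Cell (lawPow 5) 1 e m δ rin rout j) : ¬ Cell (lawPow 5) 1 e m δ rin rout j' := by
  induction hjj with
  | refl => exact h
  | step hle ih => exact fun hc => ih (cell_lawPow_five_of_succ he hδ hio hm (le_trans hj hle) hc)

end Summit.ABC.IUTFork.Repair.RH.ReqsideWeightLaws
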